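import Literature.Probability.LatticeModels.TorusFourierWeightedL1Mixed
import HarnessLib

/-!
# The `ℓ¹` norm of a space-time character sum with a PRODUCT weight (inverse sums factorise)

Topic `Literature/Probability/LatticeModels`; assembly of `TorusFourierWeightedL1Prod.lean` (Cauchy–Schwarz with a weight,
product Plancherel) and `TorusFourierWeightedL1Mixed.lean` (mixed weights ↔ mixed differences) for the PRODUCT weight
`W(a,b) = (1 + c₀ A(a)) (1 + c₁ B₁(b)) (1 + c₂ B₂(b))`, `A = (4|ã_u|/L₁)^{2N}`, `B_i = (4|b̃_{v_i}|/L₂)^{2N}`: expanding the product,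
`Σ_{a,b} W ‖S[G]‖² ≤ L₁^{d₁}L₂^{d₂} Σ_{e ∈ {0,1}³} c₀^{e₀}c₁^{e₁}c₂^{e₂} Σ ‖Δ_u^{e₀N} Δ_{v₁}^{e₁N} Δ_{v₂}^{e₂N} G‖²`, whence
`Σ_{a,b} ‖S[G](a,b)‖ ≤ (Σ_{a,b} W⁻¹)^{1/2} · (that)^{1/2}` with `Σ W⁻¹ = (Σ_a (1+c₀A)⁻¹)(Σ_b (1+c₁B₁)⁻¹(1+c₂B₂)⁻¹)` a product of
one-dimensional lattice sums (Benfatto–Giuliani–Mastropietro 2006, Lemma 2.2 at finite `(β, L)`: the `L¹` norm of a single-scale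
space-time propagator from `L²` data of its symbol, sector-free).

* `prodWeight_expand` — `(1+x)(1+y)(1+z) = Σ_{e ∈ Fin 2³} x^{e₀} y^{e₁} z^{e₂}`;
* **`sum_sum_prodWeight_mul_norm_sq_le`** — the weighted `ℓ²` bound for the product weight;
* **`sum_sum_norm_prodChar_le_prodWeight`** — the `ℓ¹` bound.

Everything is proved; no definitions, no named facts.

## Sources

G. Benfatto, A. Giuliani, V. Mastropietro, Ann. Henri Poincaré 7 (2006) 809–898, Lemma 2.2 and footnote ¹
(`BenfattoGiulianiMastropietro2006`); S. Friedli, Y. Velenik, *Statistical Mechanics of Lattice Systems* (2017), §10.4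
(`FriedliVelenik2017`).
-/

noncomputable section

open Finset Complex
open scoped Real ComplexConjugate

namespace Literature.Probability.LatticeModels

variable {d₁ L₁ d₂ L₂ : ℕ} [NeZero L₁] [NeZero L₂]

omit [NeZero L₁] [NeZero L₂] in
/-- `(1+x)(1+y)(1+z) = Σ_{e ∈ {0,1}³} x^{e₀} y^{e₁} z^{e₂}`. [folklore] -/
private theorem prodWeight_expand (x y z : ℝ) :
    (1 + x) * (1 + y) * (1 + z) = ∑ e : Fin 2 × Fin 2 × Fin 2, x ^ (e.1 : ℕ) * y ^ (e.2.1 : ℕ) * z ^ (e.2.2 : ℕ) := by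
  simp only [Fintype.sum_prod_type, Fin.sum_univ_two, Fin.val_zero, Fin.val_one, pow_zero, pow_one]
  ring

omit [NeZero L₁] [NeZero L₂] in
/-- Cauchy–Schwarz with a positive weight (local copy). [folklore] -/
private theorem sum_norm_le_of_weight'' {ι : Type*} (s : Finset ι) (g : ι → ℂ) (W : ι → ℝ) (hW : ∀ x ∈ s, 0 < W x) :
    ∑ x ∈ s, ‖g x‖ ≤ Real.sqrt (∑ x ∈ s, (W x)⁻¹) * Real.sqrt (∑ x ∈ s, W x * ‖g x‖ ^ 2) := by
  have hcs := sum_mul_sq_le_sq_mul_sq s (fun x => Real.sqrt ((W x)⁻¹)) (fun x => Real.sqrt (W x) * ‖g x‖)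
  have hprod : ∀ x ∈ s, Real.sqrt ((W x)⁻¹) * (Real.sqrt (W x) * ‖g x‖) = ‖g x‖ := by
    intro x hx
    rw [← mul_assoc, Real.sqrt_inv, inv_mul_cancel₀ (Real.sqrt_ne_zero'.2 (hW x hx)), one_mul]
  have h1 : ∀ x ∈ s, Real.sqrt ((W x)⁻¹) ^ 2 = (W x)⁻¹ := fun x hx => Real.sq_sqrt (inv_nonneg.2 (hW x hx).le)
  have h2 : ∀ x ∈ s, (Real.sqrt (W x) * ‖g x‖) ^ 2 = W x * ‖g x‖ ^ 2 := fun x hx => by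
    rw [mul_pow, Real.sq_sqrt (hW x hx).le]
  rw [sum_congr rfl hprod, sum_congr rfl h1, sum_congr rfl h2] at hcs
  have hA : 0 ≤ ∑ x ∈ s, (W x)⁻¹ := sum_nonneg fun x hx => inv_nonneg.2 (hW x hx).le
  have hS : 0 ≤ ∑ x ∈ s, ‖g x‖ := sum_nonneg fun x _ => norm_nonneg _
  rw [← Real.sqrt_mul hA, ← Real.sqrt_sq hS]
  exact Real.sqrt_le_sqrt hcs

/-- **Weighted `ℓ²` bound with the product weight**: with `A(a) = (4|ã_u(a)|/L₁)^{2N}`, `B_i(b) = (4|b̃_{v_i}(b)|/L₂)^{2N}` and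
`c₀, c₁, c₂ ≥ 0`,
`Σ_{a,b} (1+c₀A)(1+c₁B₁)(1+c₂B₂) ‖S[G](a,b)‖² ≤ L₁^{d₁}L₂^{d₂} Σ_{e ∈ {0,1}³} c₀^{e₀}c₁^{e₁}c₂^{e₂} Σ_{p,p'} ‖Δ_u^{e₀N}Δ_{v₁}^{e₁N}Δ_{v₂}^{e₂N} G‖²`.
[cite: BenfattoGiulianiMastropietro2006, Lemma 2.2 and (2.36aa)] -/
theorem sum_sum_prodWeight_mul_norm_sq_le (G : TorusSite d₁ L₁ → TorusSite d₂ L₂ → ℂ) (u : TorusSite d₁ L₁)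
    (v₁ v₂ : TorusSite d₂ L₂) (N : ℕ) {c₀ c₁ c₂ : ℝ} (hc₀ : 0 ≤ c₀) (hc₁ : 0 ≤ c₁) (hc₂ : 0 ≤ c₂) :
    ∑ a : TorusSite d₁ L₁, ∑ b : TorusSite d₂ L₂,
        (1 + c₀ * (4 * |((∑ j, u j * a j).valMinAbs : ℝ)| / L₁) ^ (2 * N)) *
          (1 + c₁ * (4 * |((∑ j, v₁ j * b j).valMinAbs : ℝ)| / L₂) ^ (2 * N)) *
            (1 + c₂ * (4 * |((∑ j, v₂ j * b j).valMinAbs : ℝ)| / L₂) ^ (2 * N)) *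
              ‖∑ p, ∑ p', torusChar p a * torusChar p' b * G p p'‖ ^ 2 ≤
      (L₁ : ℝ) ^ d₁ * (L₂ : ℝ) ^ d₂ * ∑ e : Fin 2 × Fin 2 × Fin 2, c₀ ^ (e.1 : ℕ) * c₁ ^ (e.2.1 : ℕ) * c₂ ^ (e.2.2 : ℕ) *
        ∑ p, ∑ p', ‖((fwdDiff u)^[(e.1 : ℕ) * N]
          (fun q => ((fwdDiff v₁)^[(e.2.1 : ℕ) * N] ((fwdDiff v₂)^[(e.2.2 : ℕ) * N] (G q))) p')) p‖ ^ 2 := by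
  -- expand the product weight pointwise into the eight mixed weights
  have hpt : ∀ (a : TorusSite d₁ L₁) (b : TorusSite d₂ L₂),
      (1 + c₀ * (4 * |((∑ j, u j * a j).valMinAbs : ℝ)| / L₁) ^ (2 * N)) *
          (1 + c₁ * (4 * |((∑ j, v₁ j * b j).valMinAbs : ℝ)| / L₂) ^ (2 * N)) *
            (1 + c₂ * (4 * |((∑ j, v₂ j * b j).valMinAbs : ℝ)| / L₂) ^ (2 * N)) *
              ‖∑ p, ∑ p', torusChar p a * torusChar p' b * G p p'‖ ^ 2 =
        ∑ e : Fin 2 × Fin 2 × Fin 2, c₀ ^ (e.1 : ℕ) * c₁ ^ (e.2.1 : ℕ) * c₂ ^ (e.2.2 : ℕ) *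
          ((4 * |((∑ j, u j * a j).valMinAbs : ℝ)| / L₁) ^ (2 * ((e.1 : ℕ) * N)) *
            ((4 * |((∑ j, v₁ j * b j).valMinAbs : ℝ)| / L₂) ^ (2 * ((e.2.1 : ℕ) * N)) *
              ((4 * |((∑ j, v₂ j * b j).valMinAbs : ℝ)| / L₂) ^ (2 * ((e.2.2 : ℕ) * N)) *
                ‖∑ p, ∑ p', torusChar p a * torusChar p' b * G p p'‖ ^ 2))) := by
    intro a b
    rw [prodWeight_expand, sum_mul]
    refine sum_congr rfl fun e _ => ?_
    rw [mul_pow, mul_pow, mul_pow, ← pow_mul, ← pow_mul, ← pow_mul]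
    ring_nf
  simp_rw [hpt]
  conv_lhs => enter [2, a]; rw [Finset.sum_comm]
  rw [Finset.sum_comm, mul_sum]
  refine sum_le_sum fun e _ => ?_
  have hce : 0 ≤ c₀ ^ (e.1 : ℕ) * c₁ ^ (e.2.1 : ℕ) * c₂ ^ (e.2.2 : ℕ) := by positivity
  have hmix := sum_sum_mixedWeight_mul_norm_sq_le G u v₁ v₂ ((e.1 : ℕ) * N) ((e.2.1 : ℕ) * N) ((e.2.2 : ℕ) * N)
  have hpull : ∑ a : TorusSite d₁ L₁, ∑ b : TorusSite d₂ L₂, c₀ ^ (e.1 : ℕ) * c₁ ^ (e.2.1 : ℕ) * c₂ ^ (e.2.2 : ℕ) *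
        ((4 * |((∑ j, u j * a j).valMinAbs : ℝ)| / L₁) ^ (2 * ((e.1 : ℕ) * N)) *
          ((4 * |((∑ j, v₁ j * b j).valMinAbs : ℝ)| / L₂) ^ (2 * ((e.2.1 : ℕ) * N)) *
            ((4 * |((∑ j, v₂ j * b j).valMinAbs : ℝ)| / L₂) ^ (2 * ((e.2.2 : ℕ) * N)) *
              ‖∑ p, ∑ p', torusChar p a * torusChar p' b * G p p'‖ ^ 2))) =
      c₀ ^ (e.1 : ℕ) * c₁ ^ (e.2.1 : ℕ) * c₂ ^ (e.2.2 : ℕ) *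
        ∑ a : TorusSite d₁ L₁, ∑ b : TorusSite d₂ L₂,
          (4 * |((∑ j, u j * a j).valMinAbs : ℝ)| / L₁) ^ (2 * ((e.1 : ℕ) * N)) *
            ((4 * |((∑ j, v₁ j * b j).valMinAbs : ℝ)| / L₂) ^ (2 * ((e.2.1 : ℕ) * N)) *
              ((4 * |((∑ j, v₂ j * b j).valMinAbs : ℝ)| / L₂) ^ (2 * ((e.2.2 : ℕ) * N)) *
                ‖∑ p, ∑ p', torusChar p a * torusChar p' b * G p p'‖ ^ 2)) := by
    rw [mul_sum]
    refine sum_congr rfl fun a _ => ?_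
    rw [mul_sum]
  rw [hpull]
  calc c₀ ^ (e.1 : ℕ) * c₁ ^ (e.2.1 : ℕ) * c₂ ^ (e.2.2 : ℕ) *
        ∑ a : TorusSite d₁ L₁, ∑ b : TorusSite d₂ L₂,
          (4 * |((∑ j, u j * a j).valMinAbs : ℝ)| / L₁) ^ (2 * ((e.1 : ℕ) * N)) *
            ((4 * |((∑ j, v₁ j * b j).valMinAbs : ℝ)| / L₂) ^ (2 * ((e.2.1 : ℕ) * N)) *
              ((4 * |((∑ j, v₂ j * b j).valMinAbs : ℝ)| / L₂) ^ (2 * ((e.2.2 : ℕ) * N)) *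
                ‖∑ p, ∑ p', torusChar p a * torusChar p' b * G p p'‖ ^ 2))
      ≤ c₀ ^ (e.1 : ℕ) * c₁ ^ (e.2.1 : ℕ) * c₂ ^ (e.2.2 : ℕ) *
          ((L₁ : ℝ) ^ d₁ * (L₂ : ℝ) ^ d₂ * ∑ p, ∑ p', ‖((fwdDiff u)^[(e.1 : ℕ) * N]
            (fun q => ((fwdDiff v₁)^[(e.2.1 : ℕ) * N] ((fwdDiff v₂)^[(e.2.2 : ℕ) * N] (G q))) p')) p‖ ^ 2) :=
        mul_le_mul_of_nonneg_left hmix hce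
    _ = (L₁ : ℝ) ^ d₁ * (L₂ : ℝ) ^ d₂ * (c₀ ^ (e.1 : ℕ) * c₁ ^ (e.2.1 : ℕ) * c₂ ^ (e.2.2 : ℕ) *
          ∑ p, ∑ p', ‖((fwdDiff u)^[(e.1 : ℕ) * N]
            (fun q => ((fwdDiff v₁)^[(e.2.1 : ℕ) * N] ((fwdDiff v₂)^[(e.2.2 : ℕ) * N] (G q))) p')) p‖ ^ 2) := by ring

/-- **The `ℓ¹` norm of a space-time character sum with the product weight**: under the hypotheses of
`sum_sum_prodWeight_mul_norm_sq_le`,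
`Σ_{a,b} ‖S[G](a,b)‖ ≤ (Σ_{a,b} ((1+c₀A)(1+c₁B₁)(1+c₂B₂))⁻¹)^{1/2} · (L₁^{d₁}L₂^{d₂} Σ_e c^e Σ‖Δ^e G‖²)^{1/2}` — the `L²` route to
the row sums of a sector-free single-scale space-time propagator, with a weight whose inverse sums FACTORISE into one-dimensional
lattice sums. [cite: BenfattoGiulianiMastropietro2006, Lemma 2.2 and footnote 1] -/
theorem sum_sum_norm_prodChar_le_prodWeight (G : TorusSite d₁ L₁ → TorusSite d₂ L₂ → ℂ) (u : TorusSite d₁ L₁)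
    (v₁ v₂ : TorusSite d₂ L₂) (N : ℕ) {c₀ c₁ c₂ : ℝ} (hc₀ : 0 ≤ c₀) (hc₁ : 0 ≤ c₁) (hc₂ : 0 ≤ c₂) :
    ∑ a : TorusSite d₁ L₁, ∑ b : TorusSite d₂ L₂, ‖∑ p, ∑ p', torusChar p a * torusChar p' b * G p p'‖ ≤
      Real.sqrt (∑ a : TorusSite d₁ L₁, ∑ b : TorusSite d₂ L₂,
          ((1 + c₀ * (4 * |((∑ j, u j * a j).valMinAbs : ℝ)| / L₁) ^ (2 * N)) *
            (1 + c₁ * (4 * |((∑ j, v₁ j * b j).valMinAbs : ℝ)| / L₂) ^ (2 * N)) *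
              (1 + c₂ * (4 * |((∑ j, v₂ j * b j).valMinAbs : ℝ)| / L₂) ^ (2 * N)))⁻¹) *
        Real.sqrt ((L₁ : ℝ) ^ d₁ * (L₂ : ℝ) ^ d₂ *
          ∑ e : Fin 2 × Fin 2 × Fin 2, c₀ ^ (e.1 : ℕ) * c₁ ^ (e.2.1 : ℕ) * c₂ ^ (e.2.2 : ℕ) *
            ∑ p, ∑ p', ‖((fwdDiff u)^[(e.1 : ℕ) * N]
              (fun q => ((fwdDiff v₁)^[(e.2.1 : ℕ) * N] ((fwdDiff v₂)^[(e.2.2 : ℕ) * N] (G q))) p')) p‖ ^ 2) := by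
  set W : TorusSite d₁ L₁ × TorusSite d₂ L₂ → ℝ := fun ab =>
    (1 + c₀ * (4 * |((∑ j, u j * ab.1 j).valMinAbs : ℝ)| / L₁) ^ (2 * N)) *
      (1 + c₁ * (4 * |((∑ j, v₁ j * ab.2 j).valMinAbs : ℝ)| / L₂) ^ (2 * N)) *
        (1 + c₂ * (4 * |((∑ j, v₂ j * ab.2 j).valMinAbs : ℝ)| / L₂) ^ (2 * N)) with hW
  set S : TorusSite d₁ L₁ × TorusSite d₂ L₂ → ℂ := fun ab => ∑ p, ∑ p', torusChar p ab.1 * torusChar p' ab.2 * G p p' with hS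
  have hWpos : ∀ ab ∈ (univ : Finset (TorusSite d₁ L₁ × TorusSite d₂ L₂)), 0 < W ab := fun ab _ => by
    rw [hW]
    exact mul_pos (mul_pos (add_pos_of_pos_of_nonneg one_pos (by positivity))
      (add_pos_of_pos_of_nonneg one_pos (by positivity))) (add_pos_of_pos_of_nonneg one_pos (by positivity))
  have hcs := sum_norm_le_of_weight'' univ S W hWpos
  rw [← univ_product_univ, sum_product, sum_product, sum_product] at hcs
  refine hcs.trans (mul_le_mul_of_nonneg_left (Real.sqrt_le_sqrt ?_) (Real.sqrt_nonneg _))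
  have h := sum_sum_prodWeight_mul_norm_sq_le G u v₁ v₂ N hc₀ hc₁ hc₂
  simp only [hW, hS] at h ⊢
  exact h

end Literature.Probability.LatticeModels

end
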